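import Mathlib.Analysis.InnerProductSpace.Basic
import Mathlib.Analysis.Normed.Operator.Basic

/-!
# `Balaban1983to89.B9Eq387QuadraticPartitionIMS` — T. Bałaban, *Propagators for lattice gauge theories in a background field*, Commun. Math. Phys.
# **99** (1985) 389–434 [Balaban1985BackgroundPropagators] p. 408 «Σ_□ h²_□ = 1», (3.87)–(3.89) p. 409, (3.101) p. 414: **THE TWO-SPACE IMS IDENTITY
# FOR A QUADRATIC PARTITION OF UNITY — `Σ_j (χ_E^j ∘ ad_j T + ad_j T ∘ χ_S^j) = 0`, `2·Σ_j χ_E^j ∘ ad_j T = Σ_j ad_j(ad_j T)`, AND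
# `Σ_j ‖T(χ_S^j x)‖² = ‖T x‖² − re⟪T x, (Σ_j ad_j ad_j T) x⟫ + Σ_j ‖(ad_j T) x‖²`** (exact; `ad_j T = χ_E^j T − T χ_S^j`; the one-space ring
# form `2Σ_j χ_j T χ_j = 2T − Σ_j [χ_j,[χ_j,T]]` included) — route R2′ STEP B8′ of the pub-balaban NE9 chain, the seam between the S-P5(b) → S-P7
# glue (`B9Eq3101DoubleCommutatorBlockSchur`'s `K = Σ_j ad_j ad_j T`, `B9Eq3101CommutatorCauchyBlockDecay`'s `‖ad_j T‖`) and the localised forms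

statement-level skeleton of published theorems with citation tags; proofs where landed; nothing here is a claim about the Yang–Mills mass gap

CITATION HEADER (lean-in-tree rule).  Audit cell `pub-balaban`, sub-cell `t4`, BINDER row NE9; filed by NE9 formalisation-swarm LEAF PROVER 01
(`b2b-balaban-t4-ne9-formalise-leaf-01`, gen 80), author of the glue port (`B9Eq3101CommutatorCauchyBlockDecay` ∕ `B9Eq3101DoubleCommutatorBlockSchur`,
the def-free ports of t4-ne9-idea-1 gen 86's `lens1-NE9TwoSpaceCauchyBlockSchur.lean` 15b376350ba30591).  §1 is the ring identity of t4-ne9-idea-1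
gen 83's scratch kernel `t4/ideate/NE9/lens1-NE9DiscreteIMS.lean` §3 (CREDIT: statement and proof idea the kernel's); §2–§3 are the TWO-SPACE form
of the same identity written in the glue's letters (this seat's; [folklore] IMS localisation — Ismagilov, Morgan, Simon, Sigal — for `T†T` with `T`
between two spaces).  Source READ in the held text (`paper:balaban1985-cmp99-background-propagators`, journal page = PDF page + 388): p. 408, p. 409
(3.87)–(3.89), p. 414 (3.101).

THE PRINT (verbatim).  p. 408: *«We take the partition of unity {h_□} defined at the end of Sect. A in [4]. We have Σ_{□∈𝒟} h²_□ = 1.»*  p. 409,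
(3.87): *«We construct approximations G′₀, C₀, G₀ of the operators G′, (Q′G′²Q′*)⁻¹, G taking G′₀ = Σ_{□∈𝒟} h_□G′_□h_□, C₀ = Σ_{□∈𝒟} h_□C_□h_□,
G₀ = Σ_{□∈𝒟} h_□G_□h_□.»*, (3.88): *«(Δ′_a hλ)(x) = h(x)(Δ′_aλ)(x) − (K(h)λ)(x)»*, (3.89): *«|(K(h_□)G′_□h_□λ)(x)| ≤ O(M⁻¹)e^{−δ₀d(y,y′)}|λ|»*.
p. 414 (3.101): the commutator `[DPD*, h] = P₁(∂h)` *«satisfies the inequalities (3.49) with the additional small factor O(M⁻¹) … together with the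
exponential decay of DPD*»*.  Print uses the QUADRATIC partition of unity to build parametrices `Σ_□ h_□(·)_□h_□` and expands; the IMS form identity
below is the route's device for the same partition (ROUTES-NE9 §L1.2 R2′ STEP B8′ «Tier P by discrete IMS localisation»), NOT print's road; NOTHING
of [B9] is asserted.  IN THE TREE ALREADY, other currencies: `B9SectEKernel.ims_localization` (real MATRIX form `Σ_s⟨h_s x, K h_s x⟩ = ⟨x,Kx⟩ −
½⟨x,Ex⟩` for a one-space kernel, sub-cell b09) and `Support/DirichletWeightedEnergy` (the ground-state∕IMS identity for ONE weight and the flat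
Laplacian, row NE2); neither is two-space or operator-level; no declaration is shared.

WHY (route R2′ STEP B8′, S-P7 ∕ B7′-1).  The localisation error of a form `‖T x‖²` (`T = D_U`, or the NON-local `T = DP = D_U(1 − R_U)`, both maps
`L²(sites) → L²(bonds)`) against the localised forms `Σ_j ‖T(χ_j x)‖²` is EXACTLY `− re⟪Tx, Kx⟫ + Σ_j ‖(ad_j T)x‖²` with `K = Σ_j ad_j(ad_j T)` —
the operator the glue files bound: `‖K x‖ ≤ 4N√(W_rW_c)‖x‖` (`B9Eq3101DoubleCommutatorBlockSchur.norm_sum_adad_le`, volume-free) and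
`‖ad_j T‖ ≤ C∕κ₀` (`B9Eq3101CommutatorCauchyBlockDecay.norm_ad_le`), and the first-order square volume-free by the family Schur test
`Σ_j ‖a_j x‖² ≤ αβ‖x‖²` (`B9Eq3101DoubleCommutatorBlockSchur.family_block_schur_sq` at `a_j := ad_j T`).  For `T = D_U` the letters are exact Leibniz (`ad_j D` = multiplication by the
bond increment of `χ_j`, gen 83 §1 ∕ `B9Eq3105Sum` §1); this file is agnostic: every map is a letter.

WHAT IS PROVED (sorry-free; proof lane — no `def`, no `Prop` placeholder; [folklore]).
* §1 RING LEVEL (any `Ring R`, finite family with `Σ_j χ_j·χ_j = 1`): **`two_mul_sum_conj_eq_of_sq_sum_one`** (`2·Σ_j χ_jTχ_j = 2T − Σ_j (χ_j(χ_jT − Tχ_j)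
  − (χ_jT − Tχ_j)χ_j)`) — gen 83 §3.
* §2 TWO-SPACE OPERATOR LEVEL (`NontriviallyNormedField 𝕜`, `T : S →L[𝕜] E`, letters `ad j` with `had : ∀ j T, ad j T = χ_E j ∘L T − T ∘L χ_S j`,
  partitions `hS : Σ_j χ_S j ∘L χ_S j = 1`, `hE : Σ_j χ_E j ∘L χ_E j = 1`): `comp_chiS_eq` (`T ∘ χ_S j = χ_E j ∘ T − ad_j T`),
  **`sum_chiE_comp_ad_add_ad_comp_chiS_eq_zero`** (`Σ_j (χ_E j ∘ ad_j T + ad_j T ∘ χ_S j) = 0`), **`two_smul_sum_chiE_comp_ad_eq`**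
  (`2•Σ_j χ_E j ∘ ad_j T = Σ_j ad_j(ad_j T)`), `two_smul_sum_ad_comp_chiS_eq` (`2•Σ_j ad_j T ∘ χ_S j = −Σ_j ad_j(ad_j T)`).
* §3 FORM LEVEL (`RCLike 𝕜`, inner product spaces; `χ_E j` symmetric `⟪χ_E j y, y′⟫ = ⟪y, χ_E j y′⟫`; partitions pointwise): `sum_norm_sq_chi_apply`
  (`Σ_j ‖χ_E j y‖² = ‖y‖²`), **`sum_norm_sq_apply_chi_eq`** — THE TWO-SPACE IMS IDENTITY `Σ_j ‖T(χ_S j x)‖² = ‖Tx‖² − re⟪Tx, Kx⟫ + Σ_j ‖(ad_j T)x‖²`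
  for any `K` with `2•K x = 2•Σ_j χ_E j (ad_j T x)` read through §2 (stated with the letter `hK : ∀ x, K x = Σ_j ad_j (ad_j T) x`);
  **`norm_sq_le_sum_localised_add`** (`‖Tx‖² ≤ Σ_j ‖T(χ_S j x)‖² + ‖Tx‖·‖Kx‖` — local lower bounds transfer to the whole at the price of `K`),
  **`sum_localised_le_norm_sq_add`** (`Σ_j ‖T(χ_S j x)‖² ≤ ‖Tx‖² + ‖Tx‖·‖Kx‖ + Σ_j ‖(ad_j T)x‖²`).  §4 non-vacuity (one cutoff `χ = 1`).
HONEST SCOPE.  Exact algebra; no lattice, no cutoff constructed, no estimate of `K` or `ad_j T` (those are the glue files' letters); ONE seam of ONE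
sub-step of a route step, NOT NE9 (cell pub-balaban: NE9 NOT PRINTED ∕ NOT PROVED; «NE9 ⇐ the named binders»; spine PROVED 0∕9; rung (B)+1 on a finite
T⁴ — NOT infinite volume, NOT mass gap, NOT Clay; HONEST DEPENDENCY: continuum YM on T⁴ ⇐ BetaPertH ∧ nine spine estimates (0/9 proved); BetaPertH ⇐
(D1) ∧ (D4) ∧ CAP+tail; G-an2-4 gates asym, D1 and NE2/3/4).  NEW file, Mathlib-only imports; nothing modified.  Net new unproved facts: 0.
-/

namespace Literature.MathematicalPhysics.QuantumFieldTheory.Balaban1983to89.B9Eq387QuadraticPartitionIMS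

open ContinuousLinearMap
open scoped BigOperators InnerProductSpace

/-! ## §1 Ring level: `2Σ_j χ_j T χ_j = 2T − Σ_j [χ_j,[χ_j,T]]` -/

section RingLevel

variable {R : Type*} [Ring R] {J : Type*}

/-- **ONE-SPACE IMS IN A RING**: `Σ_j χ_j² = 1` ⇒ `2·Σ_j χ_jTχ_j = 2T − Σ_j (χ_j[χ_j,T] − [χ_j,T]χ_j)`. [folklore] (IMS localisation; t4-ne9-idea-1
gen 83 kernel §3) [cite: Balaban1985BackgroundPropagators, p.408 «Σ h²_□ = 1», (3.87) p.409] -/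
theorem two_mul_sum_conj_eq_of_sq_sum_one (s : Finset J) (χ : J → R) (T : R) (h1 : ∑ j ∈ s, χ j * χ j = 1) :
    2 * ∑ j ∈ s, χ j * T * χ j = 2 * T - ∑ j ∈ s, (χ j * (χ j * T - T * χ j) - (χ j * T - T * χ j) * χ j) := by
  have hexp : ∀ j ∈ s, χ j * (χ j * T - T * χ j) - (χ j * T - T * χ j) * χ j =
      χ j * χ j * T + T * (χ j * χ j) - 2 * (χ j * T * χ j) := fun j _ => by noncomm_ring
  rw [Finset.sum_congr rfl hexp, Finset.sum_sub_distrib, Finset.sum_add_distrib, ← Finset.sum_mul, ← Finset.mul_sum, h1,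
    ← Finset.mul_sum]
  noncomm_ring

end RingLevel

/-! ## §2 Two-space operator level: the first-order terms of the localisation sum to half the double commutator -/

section Operator

variable {𝕜 : Type*} [NontriviallyNormedField 𝕜]
  {S E : Type*} [NormedAddCommGroup S] [NormedSpace 𝕜 S] [NormedAddCommGroup E] [NormedSpace 𝕜 E]
  {J : Type*} (s : Finset J) (χE : J → E →L[𝕜] E) (χS : J → S →L[𝕜] S) {ad : J → (S →L[𝕜] E) → (S →L[𝕜] E)}

/-- `T ∘ χ_S^j = χ_E^j ∘ T − ad_j T`. [folklore] [cite: Balaban1985BackgroundPropagators, (3.101) p.414] -/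
theorem comp_chiS_eq (had : ∀ j T, ad j T = χE j ∘L T - T ∘L χS j) (T : S →L[𝕜] E) (j : J) :
    T ∘L χS j = χE j ∘L T - ad j T := by
  rw [had]; abel

/-- **THE FIRST-ORDER TERMS CANCEL IN PAIRS**: `Σ_j χ_S^j² = 1` on `S` and `Σ_j χ_E^j² = 1` on `E` ⇒ `Σ_j (χ_E^j ∘ ad_j T + ad_j T ∘ χ_S^j) = 0`.
[folklore] (IMS localisation) [cite: Balaban1985BackgroundPropagators, p.408 «Σ h²_□ = 1», (3.87) p.409] -/
theorem sum_chiE_comp_ad_add_ad_comp_chiS_eq_zero (had : ∀ j T, ad j T = χE j ∘L T - T ∘L χS j)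
    (hS : ∑ j ∈ s, χS j ∘L χS j = 1) (hE : ∑ j ∈ s, χE j ∘L χE j = 1) (T : S →L[𝕜] E) :
    ∑ j ∈ s, (χE j ∘L ad j T + ad j T ∘L χS j) = 0 := by
  have hexp : ∀ j ∈ s, χE j ∘L ad j T + ad j T ∘L χS j = (χE j ∘L χE j) ∘L T - T ∘L (χS j ∘L χS j) := fun j _ => by
    rw [had]
    ext x
    simp only [add_apply, comp_apply, sub_apply, map_sub]
    abel
  rw [Finset.sum_congr rfl hexp, Finset.sum_sub_distrib, ← finsetSum_comp, ← comp_finsetSum, hS, hE]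
  ext x
  simp

/-- **`2•Σ_j χ_E^j ∘ ad_j T = Σ_j ad_j(ad_j T)`** — the sum of the one-sided first-order terms IS half the double commutator `K`. [folklore]
(IMS localisation) [cite: Balaban1985BackgroundPropagators, p.408, (3.87) p.409, (3.101) p.414] -/
theorem two_smul_sum_chiE_comp_ad_eq (had : ∀ j T, ad j T = χE j ∘L T - T ∘L χS j)
    (hS : ∑ j ∈ s, χS j ∘L χS j = 1) (hE : ∑ j ∈ s, χE j ∘L χE j = 1) (T : S →L[𝕜] E) :
    (2 : 𝕜) • ∑ j ∈ s, χE j ∘L ad j T = ∑ j ∈ s, ad j (ad j T) := by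
  have h0 := sum_chiE_comp_ad_add_ad_comp_chiS_eq_zero s χE χS had hS hE T
  have hK : ∑ j ∈ s, ad j (ad j T) = ∑ j ∈ s, χE j ∘L ad j T - ∑ j ∈ s, ad j T ∘L χS j := by
    rw [← Finset.sum_sub_distrib]
    exact Finset.sum_congr rfl fun j _ => by rw [had j (ad j T)]
  rw [Finset.sum_add_distrib] at h0
  rw [hK, two_smul, eq_sub_iff_add_eq, add_assoc, h0, add_zero]

/-- … and `2•Σ_j ad_j T ∘ χ_S^j = −Σ_j ad_j(ad_j T)`. [folklore] (IMS localisation) [cite: Balaban1985BackgroundPropagators, p.408, (3.87) p.409] -/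
theorem two_smul_sum_ad_comp_chiS_eq (had : ∀ j T, ad j T = χE j ∘L T - T ∘L χS j)
    (hS : ∑ j ∈ s, χS j ∘L χS j = 1) (hE : ∑ j ∈ s, χE j ∘L χE j = 1) (T : S →L[𝕜] E) :
    (2 : 𝕜) • ∑ j ∈ s, ad j T ∘L χS j = -∑ j ∈ s, ad j (ad j T) := by
  have h0 := sum_chiE_comp_ad_add_ad_comp_chiS_eq_zero s χE χS had hS hE T
  rw [Finset.sum_add_distrib, add_eq_zero_iff_eq_neg'] at h0
  rw [← two_smul_sum_chiE_comp_ad_eq s χE χS had hS hE T, h0, smul_neg]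

end Operator

/-! ## §3 Form level: the two-space IMS identity for `‖T x‖²` -/

section Form

variable {𝕜 : Type*} [RCLike 𝕜]
  {S E : Type*} [NormedAddCommGroup S] [InnerProductSpace 𝕜 S] [NormedAddCommGroup E] [InnerProductSpace 𝕜 E]
  {J : Type*} (s : Finset J) (χE : J → E →L[𝕜] E) (χS : J → S →L[𝕜] S) {ad : J → (S →L[𝕜] E) → (S →L[𝕜] E)}

/-- `Σ_j ‖χ_E^j y‖² = ‖y‖²` for a symmetric quadratic partition of unity on `E`. [folklore] [cite: Balaban1985BackgroundPropagators, p.408 «Σ h²_□ = 1»] -/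
theorem sum_norm_sq_chi_apply (hE : ∀ y, ∑ j ∈ s, χE j (χE j y) = y) (hEsa : ∀ j y y', ⟪χE j y, y'⟫_𝕜 = ⟪y, χE j y'⟫_𝕜) (y : E) :
    ∑ j ∈ s, ‖χE j y‖ ^ 2 = ‖y‖ ^ 2 := by
  have h : ∀ j ∈ s, (‖χE j y‖ ^ 2 : ℝ) = RCLike.re ⟪y, χE j (χE j y)⟫_𝕜 := fun j _ => by
    rw [← hEsa, inner_self_eq_norm_sq (𝕜 := 𝕜)]
  rw [Finset.sum_congr rfl h, ← map_sum, ← inner_sum, hE, inner_self_eq_norm_sq (𝕜 := 𝕜)]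

/-- **THE TWO-SPACE IMS IDENTITY**: for `T : S → E`, symmetric quadratic partitions `Σ_j χ_S^j² = 1`, `Σ_j χ_E^j² = 1`, and the letters
`ad_j T = χ_E^j T − T χ_S^j`, `K = Σ_j ad_j(ad_j T)`:  `Σ_j ‖T(χ_S^j x)‖² = ‖T x‖² − re⟪T x, K x⟫ + Σ_j ‖(ad_j T) x‖²` — the localisation error is
the double-commutator operator of the glue files plus a non-negative first-order square. [folklore] (IMS localisation, two-space form)
[cite: Balaban1985BackgroundPropagators, p.408 «Σ h²_□ = 1», (3.87)–(3.89) p.409, (3.101) p.414] -/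
theorem sum_norm_sq_apply_chi_eq (had : ∀ j T, ad j T = χE j ∘L T - T ∘L χS j)
    (hS : ∑ j ∈ s, χS j ∘L χS j = 1) (hE : ∑ j ∈ s, χE j ∘L χE j = 1)
    (hEsa : ∀ j y y', ⟪χE j y, y'⟫_𝕜 = ⟪y, χE j y'⟫_𝕜) (T : S →L[𝕜] E) {K : S →L[𝕜] E}
    (hK : K = ∑ j ∈ s, ad j (ad j T)) (x : S) :
    ∑ j ∈ s, ‖T (χS j x)‖ ^ 2 = ‖T x‖ ^ 2 - RCLike.re ⟪T x, K x⟫_𝕜 + ∑ j ∈ s, ‖ad j T x‖ ^ 2 := by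
  have hE' : ∀ y, ∑ j ∈ s, χE j (χE j y) = y := fun y => by
    simpa using congrArg (fun f : E →L[𝕜] E => f y) hE
  -- `T(χ_j x) = χ_E^j (T x) − (ad_j T) x`
  have hsplit : ∀ j ∈ s, T (χS j x) = χE j (T x) - ad j T x := fun j _ => by
    have := congrArg (fun f : S →L[𝕜] E => f x) (comp_chiS_eq χE χS had T j)
    simpa using this
  -- expand each square
  have hsq : ∀ j ∈ s, ‖T (χS j x)‖ ^ 2 =
      ‖χE j (T x)‖ ^ 2 - 2 * RCLike.re ⟪χE j (T x), ad j T x⟫_𝕜 + ‖ad j T x‖ ^ 2 := fun j hj => by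
    rw [hsplit j hj, @norm_sub_sq 𝕜]
  rw [Finset.sum_congr rfl hsq, Finset.sum_add_distrib, Finset.sum_sub_distrib, sum_norm_sq_chi_apply s χE hE' hEsa,
    ← Finset.mul_sum]
  -- the cross terms: `Σ_j re⟪χ_E^j Tx, ad_j T x⟫ = re⟪Tx, (Σ_j χ_E^j ad_j T) x⟫ = ½ re⟪Tx, K x⟫`
  have hcross : ∑ j ∈ s, RCLike.re ⟪χE j (T x), ad j T x⟫_𝕜 = RCLike.re ⟪T x, (∑ j ∈ s, χE j ∘L ad j T) x⟫_𝕜 := by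
    rw [sum_apply, inner_sum, map_sum]
    exact Finset.sum_congr rfl fun j _ => by rw [hEsa, comp_apply]
  have h2K : (2 : 𝕜) • (∑ j ∈ s, χE j ∘L ad j T) x = K x := by
    rw [← smul_apply, two_smul_sum_chiE_comp_ad_eq s χE χS had hS hE T, hK]
  have hre : 2 * RCLike.re ⟪T x, (∑ j ∈ s, χE j ∘L ad j T) x⟫_𝕜 = RCLike.re ⟪T x, K x⟫_𝕜 := by
    rw [← h2K, inner_smul_right, show (2 : 𝕜) = ((2 : ℝ) : 𝕜) by norm_cast, RCLike.re_ofReal_mul]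
  rw [hcross, hre]

/-- **LOCAL LOWER BOUNDS TRANSFER TO THE WHOLE AT THE PRICE OF `K`**: `‖T x‖² ≤ Σ_j ‖T(χ_S^j x)‖² + ‖T x‖·‖K x‖`. [folklore] (IMS localisation)
[cite: Balaban1985BackgroundPropagators, (3.87)–(3.89) p.409, (3.101) p.414] -/
theorem norm_sq_le_sum_localised_add (had : ∀ j T, ad j T = χE j ∘L T - T ∘L χS j)
    (hS : ∑ j ∈ s, χS j ∘L χS j = 1) (hE : ∑ j ∈ s, χE j ∘L χE j = 1)
    (hEsa : ∀ j y y', ⟪χE j y, y'⟫_𝕜 = ⟪y, χE j y'⟫_𝕜) (T : S →L[𝕜] E) {K : S →L[𝕜] E}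
    (hK : K = ∑ j ∈ s, ad j (ad j T)) (x : S) :
    ‖T x‖ ^ 2 ≤ ∑ j ∈ s, ‖T (χS j x)‖ ^ 2 + ‖T x‖ * ‖K x‖ := by
  rw [sum_norm_sq_apply_chi_eq s χE χS had hS hE hEsa T hK x]
  have h1 : RCLike.re ⟪T x, K x⟫_𝕜 ≤ ‖T x‖ * ‖K x‖ := (RCLike.re_le_norm _).trans (norm_inner_le_norm _ _)
  have h2 : 0 ≤ ∑ j ∈ s, ‖ad j T x‖ ^ 2 := Finset.sum_nonneg fun j _ => sq_nonneg _
  linarith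

/-- … and the localised forms exceed the whole by at most `‖Tx‖·‖Kx‖ + Σ_j ‖(ad_j T)x‖²`. [folklore] (IMS localisation)
[cite: Balaban1985BackgroundPropagators, (3.87)–(3.89) p.409, (3.101) p.414] -/
theorem sum_localised_le_norm_sq_add (had : ∀ j T, ad j T = χE j ∘L T - T ∘L χS j)
    (hS : ∑ j ∈ s, χS j ∘L χS j = 1) (hE : ∑ j ∈ s, χE j ∘L χE j = 1)
    (hEsa : ∀ j y y', ⟪χE j y, y'⟫_𝕜 = ⟪y, χE j y'⟫_𝕜) (T : S →L[𝕜] E) {K : S →L[𝕜] E}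
    (hK : K = ∑ j ∈ s, ad j (ad j T)) (x : S) :
    ∑ j ∈ s, ‖T (χS j x)‖ ^ 2 ≤ ‖T x‖ ^ 2 + ‖T x‖ * ‖K x‖ + ∑ j ∈ s, ‖ad j T x‖ ^ 2 := by
  rw [sum_norm_sq_apply_chi_eq s χE χS had hS hE hEsa T hK x]
  have h1 : -(‖T x‖ * ‖K x‖) ≤ RCLike.re ⟪T x, K x⟫_𝕜 := by
    have := (RCLike.re_le_norm (-⟪T x, K x⟫_𝕜)).trans ((norm_neg _).le.trans (norm_inner_le_norm _ _))
    rw [map_neg] at this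
    linarith
  linarith

end Form

/-! ## §4 Non-vacuity -/

section NonVacuity

variable {𝕜 : Type*} [RCLike 𝕜] {S E : Type*} [NormedAddCommGroup S] [InnerProductSpace 𝕜 S] [NormedAddCommGroup E] [InnerProductSpace 𝕜 E]

/-- ONE cutoff `χ = 1` on both spaces: the partitions hold, `ad T = 0`, `K = 0`, and §3 reads `‖T x‖² = ‖T x‖² − 0 + 0`. [folklore]
[cite: Balaban1985BackgroundPropagators, p.408] -/
example (T : S →L[𝕜] E) (x : S) :
    ∑ _j ∈ (Finset.univ : Finset Unit), ‖T ((1 : S →L[𝕜] S) x)‖ ^ 2 =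
      ‖T x‖ ^ 2 - RCLike.re ⟪T x, (∑ _j ∈ (Finset.univ : Finset Unit),
        ((1 : E →L[𝕜] E) ∘L ((1 : E →L[𝕜] E) ∘L T - T ∘L (1 : S →L[𝕜] S)) -
          ((1 : E →L[𝕜] E) ∘L T - T ∘L (1 : S →L[𝕜] S)) ∘L (1 : S →L[𝕜] S))) x⟫_𝕜 +
        ∑ _j ∈ (Finset.univ : Finset Unit), ‖((1 : E →L[𝕜] E) ∘L T - T ∘L (1 : S →L[𝕜] S)) x‖ ^ 2 :=
  sum_norm_sq_apply_chi_eq (Finset.univ : Finset Unit) (fun _ => (1 : E →L[𝕜] E)) (fun _ => (1 : S →L[𝕜] S))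
    (ad := fun _ T => (1 : E →L[𝕜] E) ∘L T - T ∘L (1 : S →L[𝕜] S)) (fun _ _ => rfl) (by ext; simp) (by ext; simp)
    (fun _ _ _ => by simp) T rfl x

end NonVacuity

end Literature.MathematicalPhysics.QuantumFieldTheory.Balaban1983to89.B9Eq387QuadraticPartitionIMS
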